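import Literature.Geometry.Riemannian.RoundSphere
import Literature.Geometry.Riemannian.RiemannianDistance
import Literature.Geometry.Riemannian.ConstantCurvature
import Literature.Geometry.Riemannian.KillingHopfPositive
import Literature.Geometry.Riemannian.SphericalSpaceFormOfConstantCurvature
import Literature.Geometry.Riemannian.SectionalPinchingEstimate
import Literature.Geometry.Lorentzian.LeviCivitaProofs
import Literature.Geometry.Lorentzian.LeviCivitaCurvature
import Literature.Topology.FourManifolds.ClosedBall
import Literature.Topology.FourManifolds.PoincareThreeClassification
import Mathlib.Geometry.Manifold.Diffeomorph

/-!
# Crux `PEFillNearRound` (stmt-SmoothPoincare4-7997), line `Sketch`, helper piece `helper_rfg_killingHopfIsometry` of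
# RoundFilled-general (= the registered `stub_roundFilled` of item stmt-SmoothPoincare4-18033
# `PEFillStandardSphere`: a round metric on ANY closed 4-manifold diffeomorphic to `S⁴` is the conformal
# infinity of a Poincaré–Einstein 5-manifold — hyperbolic 5-space transported along the Killing–Hopf isometry)

Killing–Hopf with the isometry retained: a compact simply connected Riemannian 4-manifold of constant sectional curvature `1` is ISOMETRIC to the round `S⁴` — the local isometry `F : S⁴ → M` of `SphereLocalIsometry.exists_isLocalIsometry` is a surjective local diffeomorphism whose deck group is trivial because `M` is simply connected (covering argument of `IsSphericalSpaceForm.nonempty_diffeomorph_sphere_of_simplyConnectedSpace`), hence a diffeomorphism preserving the metrics.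
-/

noncomputable section

-- the prescribed namespace `Summit.<P>.<Sub>.…` duplicates `SmoothPoincare4` (P = Sub)
set_option linter.dupNamespace false

open scoped Manifold ContDiff Topology RealInnerProductSpace
open Set Function Metric Bundle TopologicalSpace Module
open Literature.Geometry.Lorentzian Literature.Geometry.Lorentzian.PseudoRiemannianMetric
open Literature.Geometry.Riemannian Literature.Topology.FourManifolds

namespace Summit.SmoothPoincare4.SmoothPoincare4.Cruxes.PEFillNearRound.RoundFilled

/-- **Killing–Hopf, simply connected case, with the isometry** (Lee 2018, Thm. 12.4): a compact simply connected `C^∞` Riemannian 4-manifold with `Rm = (g∧g)/2` for its Levi-Civita connection admits a diffeomorphism `Φ : S⁴ → M` with `g(dΦ X, dΦ Y) = g_round(X, Y)`. -/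
theorem helper_rfg_killingHopfIsometry :
    ∀ (M : Type) [TopologicalSpace M] [T2Space M] [SecondCountableTopology M] [ChartedSpace (EuclideanSpace ℝ (Fin 4)) M] [IsManifold (𝓡 4) ∞ M] [CompactSpace M] [ConnectedSpace M] [SimplyConnectedSpace M] (g : Literature.Geometry.Lorentzian.PseudoRiemannianMetric (𝓡 4) ∞ (EuclideanSpace ℝ (Fin 4)) (TangentSpace (𝓡 4) : M → Type _)) [_i : g.HasLeviCivita], g.IsRiemannian → g.HasConstantSectionalCurvatureWith g.leviCivita 1 → ∃ Φ : ↥(Metric.sphere (0 : EuclideanSpace ℝ (Fin 5)) 1) ≃ₘ⟮𝓡 4, 𝓡 4⟯ M, ∀ (x : ↥(Metric.sphere (0 : EuclideanSpace ℝ (Fin 5)) 1)) (X Y : TangentSpace (𝓡 4) x), g.val (Φ x) (mfderiv (𝓡 4) (𝓡 4) Φ x X) (mfderiv (𝓡 4) (𝓡 4) Φ x Y) = (@Literature.Geometry.Riemannian.roundMetric (EuclideanSpace ℝ (Fin 5)) _ _ 4 (Literature.Topology.FourManifolds.fact_finrank_euclideanSpace_succ 4)).val x X Y := by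
  intro M _ _ _ _ _ _ _ _ g _i hg hK
  -- the sphere instances under the explicit `Fact`, and the Levi-Civita connection of `g_round`
  haveI hfact : Fact (finrank ℝ (EuclideanSpace ℝ (Fin 5)) = 4 + 1) :=
    fact_finrank_euclideanSpace_succ 4
  haveI := (roundMetric (n := 4) (EuclideanSpace ℝ (Fin 5))).hasLeviCivita
  have h2 : (2 : ℕ∞ω) ≤ ∞ := WithTop.coe_le_coe.2 le_top
  have hc : IsGeodesicallyComplete g.leviCivita := g.isGeodesicallyComplete_of_compactSpace h2 hg
  have hdim : finrank ℝ (EuclideanSpace ℝ (Fin 4)) = 4 := finrank_euclideanSpace_fin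
  obtain ⟨pt⟩ : Nonempty M := inferInstance
  have p : sphere (0 : EuclideanSpace ℝ (Fin 5)) 1 := ⟨EuclideanSpace.single 0 1, by simp⟩
  -- Cartan: a `C^∞` local isometry `F : S⁴ → M`
  obtain ⟨F, -, hF, hiso⟩ := SphereLocalIsometry.exists_isLocalIsometry
    (V := EuclideanSpace ℝ (Fin 5)) (n := 4) (I := 𝓡 4) (by norm_num) hg hK hc hdim p pt
  have hloc : IsLocalDiffeomorph (𝓡 4) (𝓡 4) ∞ F :=
    KillingHopf.isLocalDiffeomorph_of_isometric hdim hF hiso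
  have hsurj : Surjective F := KillingHopf.surjective_of_isLocalDiffeomorph hloc
  -- its deck group: free, finite, fibres = orbits
  have hfree : ∀ A ∈ KillingHopf.deckGroup (EuclideanSpace ℝ (Fin 5)) F,
      ∀ x : sphere (0 : EuclideanSpace ℝ (Fin 5)) 1,
        A x = (x : EuclideanSpace ℝ (Fin 5)) → A = 1 :=
    fun A hA x hx ↦ KillingHopf.eq_one_of_mem_deckGroup_of_apply_eq hF hiso hA hx
  have hfin : Finite (KillingHopf.deckGroup (EuclideanSpace ℝ (Fin 5)) F) :=
    KillingHopf.finite_deckGroup hloc hfree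
  have hfib : ∀ x y : sphere (0 : EuclideanSpace ℝ (Fin 5)) 1,
      F x = F y ↔ ∃ γ ∈ KillingHopf.deckGroup (EuclideanSpace ℝ (Fin 5)) F,
        γ (y : EuclideanSpace ℝ (Fin 5)) = x := by
    intro x y
    constructor
    · intro h
      obtain ⟨A, hA, hAx⟩ :=
        KillingHopf.exists_mem_deckGroup_apply_eq (by norm_num) hdim hF hiso h.symm
      exact ⟨A, hA, hAx⟩
    · rintro ⟨γ, hγ, hγy⟩
      have h : sphereMap γ y = x := Subtype.ext hγy
      rw [← h]
      exact hγ y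
  -- `M` simply connected ⇒ the deck group is trivial ⇒ `F` is injective (covering theory)
  have hinj : Injective F := by
    letI := subgroupSphereAction (KillingHopf.deckGroup (EuclideanSpace ℝ (Fin 5)) F)
    have hcov := IsSphericalSpaceForm.isQuotientCoveringMap hfin hfree hloc hsurj hfib
    haveI : PathConnectedSpace (sphere (0 : EuclideanSpace ℝ (Fin 5)) 1) := by
      rw [← isPathConnected_iff_pathConnectedSpace]
      refine isPathConnected_sphere ?_ 0 zero_le_one
      rw [← Module.finrank_eq_rank, finrank_euclideanSpace_fin]
      norm_num
    let e : F ⁻¹' {F p} := ⟨p, rfl⟩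
    have hs := hcov.fundamentalGroupToMulOpposite_surjective e
    haveI : Subsingleton (KillingHopf.deckGroup (EuclideanSpace ℝ (Fin 5)) F)ᵐᵒᵖ :=
      hs.subsingleton
    haveI : Subsingleton (KillingHopf.deckGroup (EuclideanSpace ℝ (Fin 5)) F) :=
      MulOpposite.op_injective.subsingleton
    intro x y hxy
    obtain ⟨γ, hγ, h⟩ := (hfib x y).1 hxy
    have h1 : (⟨γ, hγ⟩ : KillingHopf.deckGroup (EuclideanSpace ℝ (Fin 5)) F) = 1 :=
      Subsingleton.elim _ _
    have hγ1 : γ = 1 := congrArg Subtype.val h1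
    subst hγ1
    exact Subtype.ext (by simpa using h.symm)
  -- the bijective local diffeomorphism `F` is a diffeomorphism, isometric by construction
  refine ⟨hloc.diffeomorphOfBijective ⟨hinj, hsurj⟩, fun x X Y ↦ ?_⟩
  exact hiso x X Y

end Summit.SmoothPoincare4.SmoothPoincare4.Cruxes.PEFillNearRound.RoundFilled

end
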